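import Summits.AtomisticToContinuum.FouriersLaw.Theorems.BondHeatUncertaintySubdiffusiveBondHeatKernelDetailedBalanceLaplaceA
import Summits.AtomisticToContinuum.FouriersLaw.Theorems.BondHeatUncertaintyExtensiveSnapshotIrreversibilityClausiusBudgetKinetics
import Mathlib.Topology.UniformSpace.UniformApproximation

/-!
# `HonestZwanzig.FeshbachIdentities`, part 4: `L²(μ_T)` contraction and time continuity of correlations

Support file for item `stmt-AtomisticToContinuum-12697` (`HonestZwanzig.FeshbachIdentities`), inputs of the
positivity of the Laplace-transformed energy–energy correlation matrix `G(s)` (clause (iv-b)). Pinned anharmonic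
chain `P = pinnedChain ω₂ lam β γ` (`ω₂ > 0`, `lam ≥ 0`, `β, γ > 0`), `N ≥ 1`, `T > 0`, `μ_T = gibbsMeasure N T`,
`P_u = transitionKernel N T T u`:

* (imported) `ClausiusBudget.pinnedChain_integral_sq_act_le_of_stronglyMeasurable` — the `L²(μ_T)`-contraction
  `∫ (P_u W)² dμ_T ≤ ∫ W² dμ_T` for (strongly) MEASURABLE `W = O(e^{ϑH})`, which the resolvent `R_s u` satisfies;
* `pinnedChain_continuous_corr_of_sq_integrable` — **time continuity**: for `F` strongly measurable with
  `F² ∈ L¹(μ_T)` and a nice (continuous, `O(e^{ϑH})`) `g`, `u ↦ ∫ F · P_{u⁺} g dμ_T` is continuous on `ℝ` — the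
  uniform limit (weighted Cauchy–Schwarz + contraction) of the continuous correlations with the bounded truncations
  `max(-M, min(M, g))` (dominated convergence along the continuous flow), as in `pinnedChain_continuous_kinCorr`.
-/

noncomputable section

open MeasureTheory ProbabilityTheory Filter Topology Set Function
open scoped NNReal ENNReal
open Literature.MathematicalPhysics.KineticTheory.HeatConduction
open Literature.MathematicalPhysics.KineticTheory Literature.Probability.Process OscillatorChain
open Summit.AtomisticToContinuum.FouriersLaw.Theorems.SubdiffusiveBondHeat
open Summit.AtomisticToContinuum.FouriersLaw.Theorems.OddSectorIrreversibility
open Summit.AtomisticToContinuum.FouriersLaw.Theorems.ExtensiveSnapshotIrreversibility.ClausiusBudget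

namespace Summit.AtomisticToContinuum.FouriersLaw.Theorems.HonestZwanzig

variable {N : ℕ}

section Pinned

variable {ω₂ lam β γ : ℝ} (hω : 0 < ω₂) (hl : 0 ≤ lam) (hβ : 0 < β) (hγ : 0 < γ) (hN : 0 < N)
  {T : ℝ} (hT : 0 < T)
include hω hl hβ hγ hN hT

/-! ### Integrability of measurable exponentially dominated observables -/

omit hω hl hβ hγ hN hT in
/-- Strongly measurable functions dominated by `C e^{θH}` are integrable for a measure integrating `e^{θH}`.
[folklore] -/
theorem integrable_of_abs_le_exp_of_stronglyMeasurable {μ : Measure (PhaseSpace N)} {θ C : ℝ}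
    (hint : Integrable (fun y => Real.exp (θ * (pinnedChain ω₂ lam β γ).hamiltonian N y)) μ)
    {g : PhaseSpace N → ℝ} (hg : StronglyMeasurable g)
    (hle : ∀ y, |g y| ≤ C * Real.exp (θ * (pinnedChain ω₂ lam β γ).hamiltonian N y)) : Integrable g μ :=
  (hint.const_mul C).mono' hg.aestronglyMeasurable (Eventually.of_forall fun y => by
    rw [Real.norm_eq_abs]; exact hle y)

/-! ### Time continuity of correlations -/

omit hN hT in
/-- For `F ∈ L¹(μ_T)` and bounded continuous `g`, `u ↦ ∫ F · P_{u⁺} g dμ_T` is continuous (dominated convergence: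
`u ↦ P_{u⁺}g(z)` is continuous along the continuous flow and bounded by the bound of `g`). [folklore] -/
theorem pinnedChain_continuous_integral_mul_act_bounded {F : PhaseSpace N → ℝ}
    (hF : Integrable F ((pinnedChain ω₂ lam β γ).gibbsMeasure N T)) {g : PhaseSpace N → ℝ} (hg : Continuous g)
    {B : ℝ} (hB : ∀ y, ‖g y‖ ≤ B) :
    Continuous fun u : ℝ => ∫ z, F z * (∫ y, g y ∂((pinnedChain ω₂ lam β γ).transitionKernel N T T u.toNNReal z))
      ∂((pinnedChain ω₂ lam β γ).gibbsMeasure N T) := by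
  set P := pinnedChain ω₂ lam β γ with hP
  set μ := P.gibbsMeasure N T with hμ
  have hB0 : 0 ≤ B := (norm_nonneg _).trans (hB 0)
  have hin : ∀ u : ℝ, ∀ z, ‖∫ y, g y ∂(P.transitionKernel N T T u.toNNReal z)‖ ≤ B := fun u z =>
    pinnedChain_abs_act_le_of_bounded hω hl hβ hγ hB _ z
  refine continuous_of_dominated (bound := fun z => ‖F z‖ * B) (fun u => ?_) (fun u => Eventually.of_forall fun z => ?_)
    (hF.norm.mul_const B) (Eventually.of_forall fun z => ?_)
  · exact hF.aestronglyMeasurable.mul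
      (hg.stronglyMeasurable.integral_kernel (κ := P.transitionKernel N T T u.toNNReal)).aestronglyMeasurable
  · rw [norm_mul]
    exact mul_le_mul_of_nonneg_left (hin u z) (norm_nonneg _)
  · exact continuous_const.mul (pinnedChain_continuous_integral_transitionKernel_time hω hl hβ hγ hg hB z)

/-- **Time continuity of correlations**: for `F` strongly measurable with `F² ∈ L¹(μ_T)` and `g` continuous with
`|g| ≤ C e^{ϑH}` (`0 < ϑ`, `2ϑ < 1/T`), `u ↦ ∫ F · P_{u⁺} g dμ_T` is continuous on `ℝ`: it is the uniform limit of the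
continuous correlations with the bounded truncations `g^M = max(-M, min(M, g))`, since
`|∫ F · P_u(g - g^M)| ≤ (ε ∫F² + ε⁻¹ ∫ (P_u(g - g^M))²)/2 ≤ (ε ∫ F² + ε⁻¹ ∫ (g - g^M)²)/2` and `∫ (g - g^M)² dμ_T → 0`.
[folklore] -/
theorem pinnedChain_continuous_corr_of_sq_integrable {ϑ C : ℝ} (hϑ0 : 0 < ϑ) (h2ϑ : 2 * ϑ < 1 / T)
    {F : PhaseSpace N → ℝ} (hFm : StronglyMeasurable F)
    (hF2 : Integrable (fun z => F z ^ 2) ((pinnedChain ω₂ lam β γ).gibbsMeasure N T))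
    {g : PhaseSpace N → ℝ} (hg : Continuous g)
    (hgb : ∀ y, |g y| ≤ C * Real.exp (ϑ * (pinnedChain ω₂ lam β γ).hamiltonian N y)) :
    Continuous fun u : ℝ => ∫ z, F z * (∫ y, g y ∂((pinnedChain ω₂ lam β γ).transitionKernel N T T u.toNNReal z))
      ∂((pinnedChain ω₂ lam β γ).gibbsMeasure N T) := by
  set P := pinnedChain ω₂ lam β γ with hP
  set μ := P.gibbsMeasure N T with hμ
  set κ : ℝ → Kernel (PhaseSpace N) (PhaseSpace N) := fun u => P.transitionKernel N T T u.toNNReal with hκ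
  haveI : IsProbabilityMeasure μ := pinnedChain_isProbabilityMeasure_gibbsMeasure hω hl hβ.le γ N hT
  have hϑ1 : ϑ < 1 / T := by linarith
  -- `F ∈ L¹`
  have hF1 : Integrable F μ := by
    have hI : Integrable (fun z => (1 + F z ^ 2) / 2) μ := ((integrable_const (1 : ℝ)).add hF2).div_const 2
    refine hI.mono' hFm.aestronglyMeasurable (Eventually.of_forall fun z => ?_)
    rw [Real.norm_eq_abs]
    nlinarith [sq_nonneg (|F z| - 1), sq_abs (F z), abs_nonneg (F z)]
  -- truncations of `g`
  set gM : ℕ → PhaseSpace N → ℝ := fun M z => max (-(M:ℝ)) (min (M:ℝ) (g z)) with hgM'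
  have hgMc : ∀ M, Continuous (gM M) := fun M => continuous_const.max (continuous_const.min hg)
  have hgMb : ∀ M y, ‖gM M y‖ ≤ M := fun M y => by
    rw [Real.norm_eq_abs, abs_le]
    refine ⟨le_max_left _ _, max_le (by linarith [(M.cast_nonneg : (0:ℝ) ≤ M)]) (min_le_left _ _)⟩
  have hdiffle : ∀ M y, |g y - gM M y| ≤ |g y| := fun M y => by
    simp only [hgM']
    rcases le_total 0 (g y) with h | h
    · have hmax : max (-(M:ℝ)) (min (M:ℝ) (g y)) = min (M:ℝ) (g y) :=
        max_eq_right (le_min (by linarith [(M.cast_nonneg : (0:ℝ) ≤ M)]) (by linarith [(M.cast_nonneg : (0:ℝ) ≤ M)]))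
      rw [hmax, abs_of_nonneg h]
      rcases le_total (M:ℝ) (g y) with h' | h'
      · rw [min_eq_left h', abs_of_nonneg (by linarith)]; linarith [(M.cast_nonneg : (0:ℝ) ≤ M)]
      · rw [min_eq_right h', sub_self, abs_zero]; exact h
    · have : min (M:ℝ) (g y) = g y := min_eq_right (h.trans M.cast_nonneg)
      rw [this, abs_of_nonpos h]
      rcases le_total (-(M:ℝ)) (g y) with h' | h'
      · rw [max_eq_right h', sub_self, abs_zero]; linarith
      · rw [max_eq_left h', abs_of_nonpos (by linarith)]; linarith [(M.cast_nonneg : (0:ℝ) ≤ M)]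
  have hdexp : ∀ M y, |g y - gM M y| ≤ C * Real.exp (ϑ * P.hamiltonian N y) := fun M y =>
    (hdiffle M y).trans (hgb y)
  -- `L²` facts
  set A : ℝ := ∫ z, F z ^ 2 ∂μ with hAdef
  have hA0 : 0 ≤ A := integral_nonneg fun z => sq_nonneg _
  have hg2 : Integrable (fun z => g z ^ 2) μ := (pinnedChain_integral_sq_act_le hω hl hβ hγ hN hT hϑ0 h2ϑ hg hgb 0).1
  set δ : ℕ → ℝ := fun M => ∫ z, (g z - gM M z) ^ 2 ∂μ with hδ
  have hδlim : Tendsto δ atTop (𝓝 0) := by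
    have h0 : (0:ℝ) = ∫ z, (0:ℝ) ∂μ := by simp
    rw [h0]
    refine tendsto_integral_of_dominated_convergence (fun z => g z ^ 2)
      (fun M => (((hg.sub (hgMc M)).pow 2)).aestronglyMeasurable) hg2
      (fun M => Eventually.of_forall fun z => ?_) (Eventually.of_forall fun z => ?_)
    · rw [Real.norm_eq_abs, abs_pow, ← sq_abs (g z)]
      exact pow_le_pow_left₀ (abs_nonneg _) (hdiffle M z) 2
    · refine tendsto_const_nhds.congr' ?_
      obtain ⟨M₁, hM₁⟩ := exists_nat_ge |g z|
      filter_upwards [eventually_ge_atTop M₁] with M hM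
      have hMr : |g z| ≤ M := hM₁.trans (by exact_mod_cast hM)
      have : gM M z = g z := by
        simp only [hgM']
        rw [min_eq_right (abs_le.1 hMr).2, max_eq_right (abs_le.1 hMr).1]
      simp [this]
  -- the continuous approximants
  set K : ℝ → ℝ := fun u => ∫ z, F z * (∫ y, g y ∂(κ u z)) ∂μ with hK
  set KM : ℕ → ℝ → ℝ := fun M u => ∫ z, F z * (∫ y, gM M y ∂(κ u z)) ∂μ with hKM
  have hKMc : ∀ M, Continuous (KM M) := fun M =>
    pinnedChain_continuous_integral_mul_act_bounded hω hl hβ hγ hF1 (hgMc M) (hgMb M)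
  -- uniform approximation
  have hunif : TendstoUniformly KM K atTop := by
    rw [Metric.tendstoUniformly_iff]
    intro η hη
    set ε : ℝ := η / (2 * A + 2) with hε
    have hε0 : 0 < ε := by positivity
    have hδev : ∀ᶠ M in atTop, δ M < ε * (η / 2) := (tendsto_order.1 hδlim).2 _ (by positivity)
    filter_upwards [hδev] with M hM u
    rw [Real.dist_eq]
    set uu : ℝ≥0 := u.toNNReal
    have hB2 := pinnedChain_integral_sq_act_le hω hl hβ hγ hN hT hϑ0 h2ϑ (f := fun y => g y - gM M y)
      (hg.sub (hgMc M)) (hdexp M) uu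
    haveI : IsMarkovKernel (κ u) := pinnedChain_isMarkovKernel_transitionKernel hω hl hβ.le hγ.le N T T uu
    have hgκ : ∀ z, Integrable g (κ u z) := fun z => integrable_of_abs_le_exp
      (pinnedChain_integrable_exp_mul_hamiltonian_transitionKernel hω hl hT hβ.le hγ.le hN hϑ0 hϑ1 uu z) hg hgb
    have hgMκ : ∀ z, Integrable (gM M) (κ u z) := fun z =>
      (integrable_const (M : ℝ)).mono' (hgMc M).aestronglyMeasurable (Eventually.of_forall (hgMb M))
    have hsplit : ∀ z, F z * (∫ y, g y ∂(κ u z)) - F z * (∫ y, gM M y ∂(κ u z)) =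
        F z * (∫ y, (g y - gM M y) ∂(κ u z)) := by
      intro z
      rw [integral_sub (hgκ z) (hgMκ z)]
      ring
    -- integrability of the products (AM–GM domination)
    have hprod_int : ∀ {b : PhaseSpace N → ℝ}, AEStronglyMeasurable b μ →
        Integrable (fun z => b z ^ 2) μ → Integrable (fun z => F z * b z) μ := by
      intro b hbm hb
      have hI : Integrable (fun z => (F z ^ 2 + b z ^ 2) / 2) μ := (hF2.add hb).div_const 2
      refine hI.mono' (hFm.aestronglyMeasurable.mul hbm) (Eventually.of_forall fun z => ?_)
      show ‖F z * b z‖ ≤ (F z ^ 2 + b z ^ 2) / 2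
      rw [Real.norm_eq_abs, abs_mul]
      nlinarith [sq_nonneg (|F z| - |b z|), sq_abs (F z), sq_abs (b z)]
    have hB1 := pinnedChain_integral_sq_act_le hω hl hβ hγ hN hT hϑ0 h2ϑ hg hgb uu
    have hB3 := pinnedChain_sq_act_le_of_bounded hω hl hβ hγ hN hT (hgMc M) (hgMb M) uu
    have hI0 : Integrable (fun z => F z * ∫ y, g y ∂(κ u z)) μ :=
      hprod_int (hg.stronglyMeasurable.integral_kernel (κ := κ u)).aestronglyMeasurable hB1.2.1
    have hIM : Integrable (fun z => F z * ∫ y, gM M y ∂(κ u z)) μ :=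
      hprod_int ((hgMc M).stronglyMeasurable.integral_kernel (κ := κ u)).aestronglyMeasurable hB3.2.1
    have hdiff : K u - KM M u = ∫ z, F z * ∫ y, (g y - gM M y) ∂(κ u z) ∂μ := by
      simp only [hK, hKM]
      rw [← integral_sub hI0 hIM]
      exact integral_congr_ae (Eventually.of_forall hsplit)
    have hT2 := abs_integral_mul_le_weighted hF2 hB2.2.1 hε0
    have hPd : ∫ z, (∫ y, (g y - gM M y) ∂(κ u z)) ^ 2 ∂μ ≤ δ M := hB2.2.2
    have hδ0 : 0 ≤ δ M := integral_nonneg fun z => sq_nonneg _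
    rw [hdiff]
    calc |∫ z, F z * ∫ y, (g y - gM M y) ∂(κ u z) ∂μ|
        ≤ (ε * A + ε⁻¹ * ∫ z, (∫ y, (g y - gM M y) ∂(κ u z)) ^ 2 ∂μ) / 2 := hT2
      _ ≤ (ε * A + ε⁻¹ * δ M) / 2 := by gcongr
      _ ≤ ε * A + ε⁻¹ * δ M := by
          have : 0 ≤ ε * A + ε⁻¹ * δ M := by positivity
          linarith
      _ < ε * A + ε⁻¹ * (ε * (η / 2)) := by gcongr
      _ = ε * A + η / 2 := by rw [← mul_assoc, inv_mul_cancel₀ hε0.ne', one_mul]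
      _ ≤ η := by
          rw [hε]
          have : η / (2 * A + 2) * A ≤ η / 2 := by
            rw [div_mul_eq_mul_div, div_le_div_iff₀ (by positivity) (by positivity)]
            nlinarith
          linarith
  exact hunif.continuous (Frequently.of_forall hKMc)

end Pinned

end Summit.AtomisticToContinuum.FouriersLaw.Theorems.HonestZwanzig

end
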